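import Literature.MathematicalPhysics.QuantumFieldTheory.BalabanImbrieJaffe1984to88.BIJ88TripleSplitActivity309

/-!
# `BalabanImbrieJaffe1984to88.BIJ88Ineq5144TripleLocalityWitness` — T. Bałaban, J. Imbrie, A. Jaffe, *Effective action and cluster properties of
the abelian Higgs model*, Commun. Math. Phys. **114** (1988) 257–315 [BalabanImbrieJaffe1988], Sect. 5.14 (5.14.4) p. 309 [PDF 53] with Sect. 5.13
p. 305–307 [PDF 49–51]: **A KERNEL WITNESS THAT AN INTER-CUBE COVARIANCE-DECAY LETTER, HOWEVER STRONG, DOES NOT BY ITSELF GIVE (5.14.4) ON THREE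
CUBES AT MODEL LEVEL** — the companion of p36 g18 `BIJ88Ineq5144TripleDecayWitness` (p350215: the decay letter is NECESSARY).  In the §5.13 model of
this lineage the located bound (5.14.4) on a three-cube chain stays FALSE under the complete two-cube regime of `BIJ88Ineq5144TwoCubeChi.
ineq5144_locAct_pair_of_struct_chi` (including the adjusted V-clause `K_Y e^{2GK₁} ≤ θ^{1+β′}/2`) EVEN WITH the strongest covariance letter of
decay type — RANGE ONE at every interpolation: `(Δ_s)⁻¹_{xy} = 0` whenever `x ≠ y` and `Δ_{xy} = 0`, all `s ∈ [0,1]^{cubes}` — as soon as the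
decoration sits in the MIDDLE cube and its interaction term `V_Y` (typed, as everywhere in the model, by letters on `V_Y` as a function of the
cube's fields) feels both faces of that cube.  Print's mechanism at this point is not decay but the LOCAL, SMALL-COEFFICIENT structure of
`V^{(k)}(Y)`: p. 307 *"Functional derivatives hitting e^{−V^{(k)}(Y)} yield factors e^β(L^kε/ε₀)^{1/4−α}. … Altogether we have small factors at each
end of C_ω(α)"* and p. 309 *"using the fact that V^{(k)}(Y) is a small polynomial in A^{(k)}, φ^{(k)}. [The restrictions disappear as t→0, so
V^{(k)}(Y) cannot be replaced by its supremum.]"* — two train ends landing on the same `e^{−tV(Y)}` from the two neighbours each bring down their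
own small coefficient, whereas a sup/gradient-typed `V_Y` hit twice is worth ONE letter (HOME/GAPS.md **G-C2-p36-11**, sharpening G-C2-p36-10 and
G-C2-p36-09 ADDENDUM 2).

statement-level skeleton of published theorems with citation tags; proofs where landed; nothing here is a claim about the Yang–Mills mass gap

PDF held: `paper:balaban1988-cmp114-bij-abelian-higgs-effective-action` (journal page = PDF page + 256); p. 309 (p0053.txt L12–19), verbatim: *"Let us
drop the prime, and prove that |g₃(H_β, X_β)| ≦ (e^β(L^kε/ε₀)^{1/4−α})^{[|H_β| + β′|X_β∖H_β|]}. (5.14.4) … Each factor V^{(k)}(Y) in Π (d/dt)_{γ_j}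
produces a factor e^β(L^kε/ε₀)^{1/4−α} in the final estimate. This is obtained in the Gaussian integration estimate, using the fact that V^{(k)}(Y)
is a small polynomial in A^{(k)}, φ^{(k)}. [The restrictions disappear as t→0, so V^{(k)}(Y) cannot be replaced by its supremum.]"*; p. 307
(p0051.txt L10–15) as quoted above.

WHAT IS PROVED (unit `lit-balaban-p36`, generation 18 of the Phase-2 proof seat p36; HOME/GAPS.md G-C2-p36-11; SKELETON rows C2.Eq5.14.3-5.14.4 /
C2.Eq5.14.5 of `HOME/lit-balaban-r16/ROWS-C2-part2.md`, owner r16 — informs the re-scoped flip item of v2.246, moves no head).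
* **`ineq5144_locAct_triple_rangeOneCov_false`** — the refuted statement of `BIJ88Ineq5144TripleDecayWitness.ineq5144_locAct_triple_chiRegime_false`
  (every binder identical and in the same order) with ONE MORE HYPOTHESIS inserted after the form bound: the range-one covariance letter
  `∀ s ∈ [0,1]^{cubes}, ∀ x ≠ y, Δ_{xy} = 0 → (Δ_s)⁻¹_{xy} = 0` — STILL implies `False`.  Witness (`BIJ88TripleSplitActivity309` §3): cubes
  `□₀–□₁–□₂`, `□₁ = {1, 2}` (its `□₀`-face and `□₂`-face sites), split precision `[[2,1],[1,2]] ⊕ [[2,1],[1,2]]` (`m = ½`; the letter HOLDS: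
  `split4_inv_offBlock`), `ℱ = 0`, no χ-slots, ONE interaction term `V(φ) = K e^{−φ₁²}e^{−φ₂²}` on the MIDDLE cube carrying the one `(d/dt)`, cubes
  `□₀, □₂` slot-free (located exponent `θ^{1+2β′}`), `t = 1`, `θ = 10⁻⁵`, `β′ = 1`, `K = K₁ = 10⁻¹¹ ≤ θ²/2`, `G = Λ = 1`, `c₀ = 10`, `F = 0`,
  `e_k = min(10⁻¹³, 1/(16Ĉ))`: every clause holds and the bound demands `|activity| ≤ θ³ = 10⁻¹⁵`, while by `BIJ88TripleActivity309.actIn_eq_cornerSum`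
  the activity is the third-order corner sum of `⟨−Kve^{−Kv}⟩` (`v = e^{−φ₁²}e^{−φ₂²}`) over the eight laws `1_{Λ′}`, whose values FACTOR face by
  face: `3/7 = √(3/7)·√(3/7)` (both bonds), `√(3/14) = √(3/7)·√(1/2)` (one bond), `1/2` (none), so that the corner sum is
  `−K(√(3/7) − √(1/2))² + O(K²) ≤ −K[(27/14)(1 − K) − 2·0.463 − 1] ≤ −2.5·10⁻¹⁴ < −10⁻¹⁵`.
MECHANISM-LEVEL READING (HOME/GAPS.md G-C2-p36-11; not a claim about the paper): with the decorated object `V(Y)e^{−tV(Y)}` on `□₁` reached by the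
bond `□₀–□₁` at one face and by the bond `□₁–□₂` at the other, the third-order mixed difference is the PRODUCT of the two first-order face shifts
(`√(3/7) − √(1/2)` each, `O(1)` for `O(1)` couplings) times ONE V-letter; no property of the covariance can make it small, since the covariance of
the datum already vanishes identically across `□₁`.  At model level (5.14.4) on `|X_β| ≥ 3` therefore needs, BESIDES the decay letter of
G-C2-p36-10 (for undecorated cubes not adjacent to the decoration), EITHER a locality-with-small-coefficients typing of `V_Y` (print's *"small
polynomial"*, *"small factors at each end"*) OR an adjustment exponent growing with the number of undecorated cubes adjacent to the decorated one
(here `K_Y e^{2GK₁} ≤ θ^{1+2β′}/2` would do) — the owner's call (r16), recorded as a design question, not decided here.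
HONEST SCOPE: a statement about OUR §5.13 model's hypothesis class; print's (5.14.4) for print's objects is not at issue.  0 `sorry`, 0 definitions,
0 `Prop` facts (D-0026); imports `BIJ88TripleSplitActivity309` (p36 g18) only — the refuted statement is NOT imported from
`BIJ88Ineq5144TripleDecayWitness` / `BIJ88Ineq5144TwoCubeChi` (nothing of them is used; the binder list is restated verbatim with the one insertion);
modifies nothing.  NOT summit progress; NOT continuum; NOT Clay.  Cell `lit-balaban` Phase 2, seat p36 gen 18 (owner r16, referee ref-5).
-/

noncomputable section

open Finset MeasureTheory Matrix ProbabilityTheory Filter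
open Literature.MathematicalPhysics.QuantumFieldTheory.BalabanImbrieJaffe1984to88
open BIJ88Sect2Statements (pLog)
open BIJ88Sect5Statements (CutoffProfile cutoff)
open BIJ88SlotMoments308 (slotFactor slotFactor_inr)
open BIJ88DirichletForms305 (interpForm)
open BIJ88Clusters5134 (cornerSum)
open BIJ88PolymerRep5134 (IsConn corner)
open BIJ88PolymerRep5134Gauss (ext src)
open BIJ88Eq5145CornerModel (slotB slotY regionLaw isProbabilityMeasure_regionLaw)
open BIJ88Eq5145CornerUrsell (cubeIn)
open BIJ88W6PrimeVsupp (actIn)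
open BIJ88Ineq5144Located (locAct locAct_of_loc)
open BIJ88GaussIntegration309Product (exists_const_all_orders)
open BIJ88CutoffProfileWitness (gevreyCutoff chi1_nonneg)
open BIJ88TripleActivity309 (cornerSum_triple actIn_eq_cornerSum integral_neg_mul_exp_neg_window)
open BIJ88TripleSplitActivity309

namespace Literature.MathematicalPhysics.QuantumFieldTheory.BalabanImbrieJaffe1984to88.BIJ88Ineq5144TripleLocalityWitness

/-! ## (5.14.4) on a three-cube chain FAILS in the §5.13 model even with a covariance of range one -/
section Main

/-- **NO-GO #4: A RANGE-ONE COVARIANCE DOES NOT GIVE (5.14.4) ON THREE CUBES WHEN THE DECORATION SITS IN THE MIDDLE** — the statement refuted in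
`BIJ88Ineq5144TripleDecayWitness.ineq5144_locAct_triple_chiRegime_false` (the two-cube regime of `BIJ88Ineq5144TwoCubeChi.ineq5144_locAct_pair_of_struct_chi`
with `X₂.card = 2 ↦ X₃.card = 3`: structural data, `hreg₂`, `hpre₂`, `hvac₂`, `e_k ≤ θ`, `2e_k ≤ θ^{β′}`, `K_Y e^{2GK₁} ≤ θ^{1+β′}/2`) WEAKENED by the
additional hypothesis, inserted after the form bound `m|φ|² ≤ ⟨φ,Δφ⟩`,
  `∀ s, (∀ i, 0 ≤ s i ≤ 1) → ∀ x y, x ≠ y → Δ x y = 0 → (interpForm blk Δ s)⁻¹ x y = 0`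
(the covariance has RANGE ONE at every interpolation — the strongest inter-cube decay letter: it implies `|(Δ_s)⁻¹_{xy}| ≤ Ĉδ^{n(x,y)}` for every
`δ ≥ 0` and every exponent `n` vanishing on the diagonal and on directly coupled pairs), STILL implies `False`.  Witness: the split datum of
`BIJ88TripleSplitActivity309` §3 (`□₁ = {1,2}`, `Δ = [[2,1],[1,2]] ⊕ [[2,1],[1,2]]`, the letter holds by `split4_inv_offBlock`), `V(φ) = K e^{−φ₁²}e^{−φ₂²}`
on `□₁` carrying the one `(d/dt)`, `□₀, □₂` slot-free, `t = 1`, `θ = 10⁻⁵`, `β′ = 1`, `K = K₁ = 10⁻¹¹`, `G = Λ = 1`, `m = ½`, `c₀ = 10`, `F = 0`,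
`e_k = min(10⁻¹³, 1/(16Ĉ))`: the bound demands `|activity| ≤ θ³ = 10⁻¹⁵`; the activity is the corner sum of `⟨−Kve^{−Kv}⟩`, `v = e^{−φ₁²}e^{−φ₂²}`,
with Gaussian values `3/7` (both bonds), `√12/√56 ≤ 0.463` (one bond, twice), `1/2` (five corners), hence `≤ K[2·0.463 + 1 − (27/14)(1 − K)] < −10⁻¹⁵`.
READING (HOME/GAPS.md G-C2-p36-11): the decay letter of G-C2-p36-10 is necessary (p350215) but not sufficient; what print uses here is *"small
factors at each end of C_ω(α)"* (p. 307) from the *"small polynomial"* `V^{(k)}(Y)` (p. 309), i.e. locality with small coefficients of `V_Y`, which a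
letter-typed `V_Y` does not carry. [cite: BalabanImbrieJaffe1988, (5.14.4) p.309; p.307 (Sect. 5.13); p.305–306 (Sect. 5.13)] -/
theorem ineq5144_locAct_triple_rangeOneCov_false :
    ¬ (∀ (α I : Type) [Fintype α] [DecidableEq α] [Fintype I] [DecidableEq I] (blk : α → I) (Δ : Matrix α α ℝ) (ℱ : α → ℝ)
        (adj : I → I → Prop) [DecidableRel adj] (χ : CutoffProfile) (ι υ : Type) [Fintype ι] [DecidableEq ι] [Fintype υ] [DecidableEq υ]
        (p ek : ℝ) (B : Finset ι) (Φ : ι → (α → ℝ) → ℝ) (c : ι → ℝ) (Ys : Finset υ) (V : υ → (α → ℝ) → ℝ) (cube : ↥B ⊕ ↥Ys → I)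
        (n₀ : ℕ) (C : ℝ), 1 / 2 < p → 1 ≤ C →
        (∀ i, i ≤ n₀ → ∀ (A : ℝ) ⦃q e t : ℝ⦄, q ≠ 0 → 0 < e → 0 < t → t * e ≤ Real.exp (-1) →
          |iteratedDeriv i (fun s => cutoff χ (q * pLog p (s * e)) A) t| ≤ C * t ^ (-(i : ℤ))) →
        Δ.PosDef → ∀ (m : ℝ), 0 < m → (∀ φ : α → ℝ, m * (φ ⬝ᵥ φ) ≤ φ ⬝ᵥ (Δ *ᵥ φ)) →
        (∀ s : I → ℝ, (∀ i, 0 ≤ s i ∧ s i ≤ 1) → ∀ x y : α, x ≠ y → Δ x y = 0 → (interpForm blk Δ s)⁻¹ x y = 0) →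
        (∀ x, 0 ≤ χ.χ₁ x) →
        ∀ (c₀ : ℝ), 0 < c₀ → (∀ b ∈ B, c₀ ≤ c b) → ∀ (Λ : ℝ), 0 < Λ →
        (∀ b ∈ B, ∃ ℓ₁ ℓ₂ : (α → ℝ) → ℝ, IsLinearMap ℝ ℓ₁ ∧ IsLinearMap ℝ ℓ₂ ∧
          ((∀ φ, Φ b φ = ℓ₁ φ) ∨ (∀ φ, Φ b φ = Real.sqrt (ℓ₁ φ ^ 2 + ℓ₂ φ ^ 2))) ∧
          (∀ φ, |ℓ₁ φ| ≤ Λ * Real.sqrt (φ ⬝ᵥ φ)) ∧ (∀ φ, |ℓ₂ φ| ≤ Λ * Real.sqrt (φ ⬝ᵥ φ))) →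
        ∀ (F : ℝ), 0 ≤ F → (∀ i : I, src blk ℱ {i} ⬝ᵥ src blk ℱ {i} ≤ F ^ 2) → (∀ Y ∈ Ys, Measurable (V Y)) →
        ∀ (KY : υ → ℝ), (∀ Y ∈ Ys, ∀ φ, |V Y φ| ≤ KY Y) → ∀ (K₁ : ℝ), 0 ≤ K₁ → (∀ Y ∈ Ys, KY Y ≤ K₁) →
        ∀ (G : ℕ), (∀ i, (univ.filter fun τ : ↥B ⊕ ↥Ys => cube τ = i).card ≤ G) → 0 < ek → ek ≤ Real.exp (-1) →
        ∀ (θ β' : ℝ), 0 < θ → θ ≤ 1 → 0 ≤ β' →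
        ((n₀ : ℝ) + 2 ≤ m / (8 * Λ ^ 2) * (81 / 100) * c₀ ^ 2 * Real.log ek⁻¹ ^ (2 * p - 1)) →
        (C ^ n₀ * (4 * Real.exp (F ^ 2 / m)) * Real.exp (2 * G * K₁) * ek ≤ 1) →
        (Real.exp (2 * G * K₁) * (2 * G) * (4 * Real.exp (F ^ 2 / m)) * ek + (Real.exp (2 * G * K₁) - 1) ≤ θ ^ (2 * β') / 2) →
        ek ≤ θ → 2 * ek ≤ θ ^ β' → (∀ Y ∈ Ys, KY Y * Real.exp (2 * G * K₁) ≤ θ ^ (1 + β') / 2) →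
        ∀ (Λc X : Finset I) (t : ℝ), t ∈ Set.Ioc (0 : ℝ) 1 → ∀ (L : Type) [Fintype L] [DecidableEq L], Fintype.card L ≤ n₀ →
        ∀ (γ : L → ↥(slotB B Ys cube X) ⊕ ↥(slotY B Ys cube X)) (H : Finset L) (X₃ : Finset I), X₃.card = 3 →
        |locAct (cubeIn cube X ∘ γ) (actIn blk Δ ℱ adj χ p ek B Φ c Ys V cube Λc X t γ) H X₃| ≤
          θ ^ ((H.card : ℝ) + β' * ((X₃ \ H.image (cubeIn cube X ∘ γ)).card : ℝ))) := by
  intro h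
  classical
  obtain ⟨C, hC1, hC⟩ := exists_const_all_orders gevreyCutoff 1 1
  obtain ⟨hΔ, hΔm⟩ := split4_posDef_and_ge
  -- the constants
  have hC0 : 0 < C := by linarith
  set K : ℝ := 1 / 10 ^ 11 with hK
  set θ : ℝ := 1 / 10 ^ 5 with hθ
  set ek : ℝ := min (1 / 10 ^ 13) (1 / (16 * C)) with hekdef
  obtain ⟨hK0, hθ0, hθ1⟩ : 0 < K ∧ 0 < θ ∧ θ ≤ 1 := by rw [hK, hθ]; norm_num
  have hek0 : 0 < ek := lt_min (by norm_num) (by positivity)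
  have hek13 : ek ≤ 1 / 10 ^ 13 := min_le_left _ _; have hekC : ek ≤ 1 / (16 * C) := min_le_right _ _
  have he3 : Real.exp 1 < 3 := lt_trans Real.exp_one_lt_d9 (by norm_num)
  have hek1 : ek ≤ Real.exp (-1) := le_trans (by linarith) (show (1 : ℝ) / 3 ≤ Real.exp (-1) by
    rw [Real.exp_neg, inv_eq_one_div]; exact one_div_le_one_div_of_le (Real.exp_pos 1) he3.le)
  have heK : Real.exp (2 * ((1 : ℕ) : ℝ) * K) ≤ 3 := le_trans (Real.exp_le_exp.2 (by rw [hK]; norm_num)) he3.le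
  have heK' : Real.exp (2 * ((1 : ℕ) : ℝ) * K) - 1 ≤ 2 * K + (2 * K) ^ 2 := by
    have h2 := (abs_le.1 (Real.abs_exp_sub_one_sub_id_le (show |2 * K| ≤ 1 by rw [abs_of_pos (by positivity), hK]; norm_num))).2
    rw [show 2 * ((1 : ℕ) : ℝ) * K = 2 * K by simp]; linarith
  -- the datum: three cubes, the middle one with two sites (its two faces), no χ-slots, one interaction term on the MIDDLE cube
  let cube₀ : ↥(∅ : Finset Unit) ⊕ ↥(univ : Finset Unit) → Fin 3 := fun _ => 1
  have hY0 : (⟨(), mem_univ _⟩ : ↥(univ : Finset Unit)) ∈ slotY (∅ : Finset Unit) (univ : Finset Unit) cube₀ (univ : Finset (Fin 3)) :=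
    mem_filter.2 ⟨mem_univ _, mem_univ _⟩
  let γ₀ : Unit → ↥(slotB (∅ : Finset Unit) (univ : Finset Unit) cube₀ (univ : Finset (Fin 3))) ⊕
      ↥(slotY (∅ : Finset Unit) (univ : Finset Unit) cube₀ (univ : Finset (Fin 3))) := fun _ => Sum.inr ⟨_, hY0⟩
  have hF : ∀ i : Fin 3, src (![0, 1, 1, 2] : Fin 4 → Fin 3) (0 : Fin 4 → ℝ) {i} ⬝ᵥ src (![0, 1, 1, 2] : Fin 4 → Fin 3) (0 : Fin 4 → ℝ) {i} ≤ (0 : ℝ) ^ 2 :=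
    fun i => by simp [BIJ88PolymerRep5134Gauss.src, dotProduct]
  have hVm : Measurable fun φ : Fin 4 → ℝ => K * (Real.exp (-(φ 1) ^ 2) * Real.exp (-(φ 2) ^ 2)) := Continuous.measurable (by fun_prop)
  have hVb : ∀ φ : Fin 4 → ℝ, |K * (Real.exp (-(φ 1) ^ 2) * Real.exp (-(φ 2) ^ 2))| ≤ K := fun φ => by
    rw [abs_of_nonneg (by positivity)]
    refine mul_le_of_le_one_right hK0.le (mul_le_one₀ ?_ (Real.exp_pos _).le ?_) <;>
      exact Real.exp_le_one_iff.2 (neg_nonpos.2 (sq_nonneg _))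
  have hG : ∀ i : Fin 3, (univ.filter fun τ : ↥(∅ : Finset Unit) ⊕ ↥(univ : Finset Unit) => cube₀ τ = i).card ≤ 1 := fun i =>
    (card_le_univ _).trans (by simp)
  -- the regime inequalities (`n₀ = 1`, `m = 1/2`, `Λ = 1`, `c₀ = 10`, `F = 0`, `G = 1`, `K₁ = K`, `β′ = 1`)
  have hreg₂ : (((1 : ℕ) : ℝ) + 2 ≤ (1 / 2) / (8 * (1 : ℝ) ^ 2) * (81 / 100) * (10 : ℝ) ^ 2 * Real.log ek⁻¹ ^ (2 * (1 : ℝ) - 1)) := by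
    have hinv : (10 : ℝ) ^ 13 ≤ ek⁻¹ := by rw [le_inv_comm₀ (by positivity) hek0]; rw [one_div] at hek13; exact hek13
    have hlog : 1 ≤ Real.log ek⁻¹ := by rw [Real.le_log_iff_exp_le (inv_pos.2 hek0)]; linarith
    rw [show (2 : ℝ) * 1 - 1 = 1 by norm_num, Real.rpow_one, Nat.cast_one]
    nlinarith
  have hpre₂ : C ^ 1 * (4 * Real.exp ((0 : ℝ) ^ 2 / (1 / 2))) * Real.exp (2 * ((1 : ℕ) : ℝ) * K) * ek ≤ 1 := by
    have h1 : C ^ 1 * (4 * Real.exp ((0 : ℝ) ^ 2 / (1 / 2))) * Real.exp (2 * ((1 : ℕ) : ℝ) * K) * ek ≤ C * 4 * 3 * (1 / (16 * C)) := by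
      rw [pow_one, show Real.exp ((0 : ℝ) ^ 2 / (1 / 2)) = 1 by simp, mul_one]
      gcongr
    have h2 : C * 4 * 3 * (1 / (16 * C)) = 3 / 4 := by field_simp; ring
    linarith
  have hvac₂ : Real.exp (2 * ((1 : ℕ) : ℝ) * K) * (2 * ((1 : ℕ) : ℝ)) * (4 * Real.exp ((0 : ℝ) ^ 2 / (1 / 2))) * ek +
      (Real.exp (2 * ((1 : ℕ) : ℝ) * K) - 1) ≤ θ ^ (2 * (1 : ℝ)) / 2 := by
    have h0 : Real.exp ((0 : ℝ) ^ 2 / (1 / 2)) = 1 := by simp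
    rw [h0, mul_one, show (2 : ℝ) * 1 = (2 : ℕ) by norm_num, Real.rpow_natCast]
    have h1 : Real.exp (2 * ((1 : ℕ) : ℝ) * K) * (2 * ((1 : ℕ) : ℝ)) * 4 * ek ≤ 3 * (2 * 1) * 4 * (1 / 10 ^ 13) := by gcongr; simp
    rw [hθ, hK] at *
    nlinarith
  have hekθ : ek ≤ θ := by rw [hθ]; linarith
  have hχβ : 2 * ek ≤ θ ^ (1 : ℝ) := by rw [Real.rpow_one, hθ]; linarith
  have hKθ₂ : ∀ Y ∈ (univ : Finset Unit), K * Real.exp (2 * ((1 : ℕ) : ℝ) * K) ≤ θ ^ ((1 : ℝ) + 1) / 2 := fun _ _ => by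
    rw [show (1 : ℝ) + 1 = (2 : ℕ) by norm_num, Real.rpow_natCast]
    calc K * Real.exp (2 * ((1 : ℕ) : ℝ) * K) ≤ K * 3 := by gcongr
      _ ≤ θ ^ 2 / 2 := by rw [hK, hθ]; norm_num
  -- the statement on the datum (the range-one covariance letter is `split4_inv_offBlock`)
  have hmain := h (Fin 4) (Fin 3) (![0, 1, 1, 2] : Fin 4 → Fin 3) (!![2, 1, 0, 0; 1, 2, 0, 0; 0, 0, 2, 1; 0, 0, 1, 2] : Matrix (Fin 4) (Fin 4) ℝ) 0 (fun x y => x ≠ y) gevreyCutoff Unit Unit 1 ek ∅ (fun _ _ => 0)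
    (fun _ => 1) univ (fun _ φ => K * (Real.exp (-(φ 1) ^ 2) * Real.exp (-(φ 2) ^ 2))) cube₀ 1 C (by norm_num) hC1 hC hΔ (1 / 2)
    (by norm_num) hΔm split4_inv_offBlock chi1_nonneg
    10 (by norm_num) (fun b hb => absurd hb (notMem_empty _)) 1 one_pos (fun b hb => absurd hb (notMem_empty _)) 0 le_rfl hF
    (fun _ _ => hVm) (fun _ => K) (fun _ _ φ => hVb φ) K hK0.le (fun _ _ => le_rfl) 1 hG hek0 hek1 θ 1 hθ0 hθ1 zero_le_one hreg₂ hpre₂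
    hvac₂ hekθ hχβ hKθ₂ univ univ 1 ⟨one_pos, le_rfl⟩ Unit (by simp) γ₀ univ univ (by simp)
  -- evaluate the located activity of the triple: the corner sum of the one differentiated slot under the eight region laws
  have hconn : IsConn (fun x y : Fin 3 => x ≠ y) (univ : Finset (Fin 3)) := by decide
  have hT : (univ.filter fun τ : ↥(slotB (∅ : Finset Unit) (univ : Finset Unit) cube₀ (univ : Finset (Fin 3))) ⊕
      ↥(slotY (∅ : Finset Unit) (univ : Finset Unit) cube₀ (univ : Finset (Fin 3))) =>
        cubeIn cube₀ (univ : Finset (Fin 3)) τ ∈ (univ : Finset (Fin 3))) = {Sum.inr ⟨_, hY0⟩} := by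
    ext τ
    simp only [mem_filter, mem_univ, true_and, mem_singleton]
    refine ⟨fun _ => ?_, fun _ => trivial⟩
    rcases τ with ⟨⟨b, hb⟩, _⟩ | ⟨⟨u, hu⟩, hY⟩
    · exact absurd hb (notMem_empty _)
    · rfl
  have hcard : (univ.filter fun l : Unit => γ₀ l = Sum.inr ⟨_, hY0⟩).card = 1 := by
    rw [filter_true_of_mem fun l _ => rfl, card_univ, Fintype.card_unit]
  have hext1 : ∀ ω : BIJ88PolymerRep5134Gauss.Site (![0, 1, 1, 2] : Fin 4 → Fin 3) (univ : Finset (Fin 3)) → ℝ,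
      ext (![0, 1, 1, 2] : Fin 4 → Fin 3) (univ : Finset (Fin 3)) ω 1 = ω ⟨1, mem_univ _⟩ := fun ω => by simp [BIJ88PolymerRep5134Gauss.ext]
  have hext2 : ∀ ω : BIJ88PolymerRep5134Gauss.Site (![0, 1, 1, 2] : Fin 4 → Fin 3) (univ : Finset (Fin 3)) → ℝ,
      ext (![0, 1, 1, 2] : Fin 4 → Fin 3) (univ : Finset (Fin 3)) ω 2 = ω ⟨2, mem_univ _⟩ := fun ω => by simp [BIJ88PolymerRep5134Gauss.ext]
  have hderiv : ∀ a : ℝ, deriv (fun s : ℝ => Real.exp (-(s * a))) 1 = -(a * Real.exp (-a)) := fun a => by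
    have hd : HasDerivAt (fun s : ℝ => Real.exp (-(s * a))) (Real.exp (-(1 * a)) * (-(1 * a))) 1 :=
      (((hasDerivAt_id (1 : ℝ)).mul_const a).neg).exp
    rw [hd.deriv]; ring_nf
  have h3univ : (univ : Finset (Fin 3)) = {0, 1, 2} := by decide
  rw [locAct_of_loc (fun j _ => mem_univ _), actIn_eq_cornerSum _ _ _ _ _ _ _ _ _ _ _ _ _ _ _ _ _ _ (by simp), if_pos hconn] at hmain
  simp only [hT, prod_singleton, hcard, slotFactor_inr, iteratedDeriv_one, hderiv, hext1, hext2, interpForm_corner_univ] at hmain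
  have hcs : ∀ Fc : Finset (Fin 3) → ℝ, cornerSum Fc univ = Fc univ - Fc {0, 1} - Fc {0, 2} - Fc {1, 2} + Fc {0} + Fc {1} + Fc {2} - Fc ∅ :=
    fun Fc => by rw [h3univ]; exact cornerSum_triple Fc (show (0 : Fin 3) ≠ 1 by decide) (show (0 : Fin 3) ≠ 2 by decide) (show (1 : Fin 3) ≠ 2 by decide)
  rw [hcs] at hmain
  -- the observable `v = e^{−φ₁²}e^{−φ₂²}` (the two faces of `□₁`) and the eight Gaussian values
  obtain ⟨v, hv⟩ : ∃ v : (BIJ88PolymerRep5134Gauss.Site (![0, 1, 1, 2] : Fin 4 → Fin 3) (univ : Finset (Fin 3)) → ℝ) → ℝ,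
    v = fun ω => Real.exp (-(ω ⟨1, mem_univ _⟩) ^ 2) * Real.exp (-(ω ⟨2, mem_univ _⟩) ^ 2) := ⟨_, rfl⟩
  have hvfold : ∀ ω : BIJ88PolymerRep5134Gauss.Site (![0, 1, 1, 2] : Fin 4 → Fin 3) (univ : Finset (Fin 3)) → ℝ,
    Real.exp (-(ω ⟨1, mem_univ _⟩) ^ 2) * Real.exp (-(ω ⟨2, mem_univ _⟩) ^ 2) = v ω := fun ω => by rw [hv]
  simp only [hvfold] at hmain
  haveI hP : ∀ Λ', IsProbabilityMeasure (regionLaw (![0, 1, 1, 2] : Fin 4 → Fin 3) (!![2, 1, 0, 0; 1, 2, 0, 0; 0, 0, 2, 1; 0, 0, 1, 2] : Matrix (Fin 4) (Fin 4) ℝ) (0 : Fin 4 → ℝ) (univ : Finset (Fin 3)) Λ') :=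
    fun Λ' => isProbabilityMeasure_regionLaw _ _ _ hΔ _ Λ'
  have hvm : Measurable v := by rw [hv]; fun_prop
  have hv0 : ∀ ω, 0 < v ω := fun ω => by rw [hv]; exact mul_pos (Real.exp_pos _) (Real.exp_pos _)
  have hv1 : ∀ ω, v ω ≤ 1 := fun ω => by
    rw [hv]
    exact mul_le_one₀ (Real.exp_le_one_iff.2 (neg_nonpos.2 (sq_nonneg _))) (Real.exp_pos _).le
      (Real.exp_le_one_iff.2 (neg_nonpos.2 (sq_nonneg _)))
  have hJ := fun Λ' => integral_neg_mul_exp_neg_window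
    (regionLaw (![0, 1, 1, 2] : Fin 4 → Fin 3) (!![2, 1, 0, 0; 1, 2, 0, 0; 0, 0, 2, 1; 0, 0, 1, 2] : Matrix (Fin 4) (Fin 4) ℝ) (0 : Fin 4 → ℝ) (univ : Finset (Fin 3)) Λ') hvm hv0 hv1 hK0
  have hI := fun Λ' => integral_exp_neg_sq_sq_regionLaw4 Λ'
  simp only [hvfold] at hI
  obtain ⟨c1, c2, c3, c4⟩ := interpForm_split4_corners
  obtain ⟨d1, d2, d3, d4, d5, d6, d7, d8⟩ := split4_dets
  obtain ⟨wA, wB, wC⟩ := sqrt_windows4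
  -- the eight windows
  have r123 : ∫ ω, v ω ∂(regionLaw (![0, 1, 1, 2] : Fin 4 → Fin 3) (!![2, 1, 0, 0; 1, 2, 0, 0; 0, 0, 2, 1; 0, 0, 1, 2] : Matrix (Fin 4) (Fin 4) ℝ) (0 : Fin 4 → ℝ) univ univ) = 3 / 7 := by rw [hI, c1, d1, d2, wA]
  have r01 : ∫ ω, v ω ∂(regionLaw (![0, 1, 1, 2] : Fin 4 → Fin 3) (!![2, 1, 0, 0; 1, 2, 0, 0; 0, 0, 2, 1; 0, 0, 1, 2] : Matrix (Fin 4) (Fin 4) ℝ) (0 : Fin 4 → ℝ) univ {0, 1}) =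
      Real.sqrt 12 / Real.sqrt 56 := by rw [hI, c2, d3, d4]
  have r12 : ∫ ω, v ω ∂(regionLaw (![0, 1, 1, 2] : Fin 4 → Fin 3) (!![2, 1, 0, 0; 1, 2, 0, 0; 0, 0, 2, 1; 0, 0, 1, 2] : Matrix (Fin 4) (Fin 4) ℝ) (0 : Fin 4 → ℝ) univ {1, 2}) =
      Real.sqrt 12 / Real.sqrt 56 := by rw [hI, c3, d5, d6]
  have rdec : ∀ Λ' ∈ ({{0, 2}, {0}, {1}, {2}, ∅} : Finset (Finset (Fin 3))),
      ∫ ω, v ω ∂(regionLaw (![0, 1, 1, 2] : Fin 4 → Fin 3) (!![2, 1, 0, 0; 1, 2, 0, 0; 0, 0, 2, 1; 0, 0, 1, 2] : Matrix (Fin 4) (Fin 4) ℝ) (0 : Fin 4 → ℝ) univ Λ') = 1 / 2 :=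
    fun Λ' hΛ' => by rw [hI, c4 Λ' hΛ', d7, d8, wB]
  have r02 := rdec {0, 2} (by simp)
  have r0 := rdec {0} (by simp)
  have r1 := rdec {1} (by simp)
  have r2 := rdec {2} (by simp)
  have r_e := rdec ∅ (by simp)
  obtain ⟨-, u123⟩ := hJ univ
  obtain ⟨l01, -⟩ := hJ {0, 1}
  obtain ⟨l02, -⟩ := hJ {0, 2}
  obtain ⟨l12, -⟩ := hJ {1, 2}
  obtain ⟨-, u0⟩ := hJ {0}
  obtain ⟨-, u1⟩ := hJ {1}
  obtain ⟨-, u2⟩ := hJ {2}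
  obtain ⟨l_e, -⟩ := hJ ∅
  rw [r123] at u123; rw [r01] at l01; rw [r02] at l02; rw [r12] at l12; rw [r0] at u0; rw [r1] at u1; rw [r2] at u2; rw [r_e] at l_e
  -- the located exponent is `3`
  have himg : (univ : Finset Unit).image (cubeIn cube₀ (univ : Finset (Fin 3)) ∘ γ₀) = {1} := by
    ext z
    simp only [mem_image, mem_univ, true_and, mem_singleton, Function.comp_apply]
    exact ⟨fun ⟨_, hz⟩ => hz.symm, fun hz => ⟨(), hz.symm⟩⟩
  have hsd : ((((univ : Finset (Fin 3))) \ {1}).card : ℝ) = 2 := by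
    rw [show ((univ : Finset (Fin 3)) \ {1}) = {0, 2} by decide]; rfl
  rw [himg, hsd, card_univ, Fintype.card_unit, Nat.cast_one] at hmain
  have hθpow : θ ^ ((1 : ℝ) + 1 * 2) = 1 / 10 ^ 15 := by
    rw [show (1 : ℝ) + 1 * 2 = (3 : ℕ) by norm_num, Real.rpow_natCast, hθ]; norm_num
  rw [hθpow] at hmain
  have heK1 : 1 - K ≤ Real.exp (-K) := by linarith [Real.add_one_le_exp (-K)]
  have hact := (abs_le.1 hmain).1
  -- products with `e^{−K}`: lower bounds
  have pA : (3 : ℝ) / 7 * (1 - K) ≤ 3 / 7 * Real.exp (-K) := mul_le_mul_of_nonneg_left heK1 (by norm_num)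
  have pB : (1 : ℝ) / 2 * (1 - K) ≤ 1 / 2 * Real.exp (-K) := mul_le_mul_of_nonneg_left heK1 (by norm_num)
  rw [hK] at hact u123 l01 l02 l12 u0 u1 u2 l_e pA pB
  linarith [wC]

end Main

end Literature.MathematicalPhysics.QuantumFieldTheory.BalabanImbrieJaffe1984to88.BIJ88Ineq5144TripleLocalityWitness

end
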